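import Mathlib.Analysis.Complex.Harmonic.MeanValue
import Mathlib.Analysis.InnerProductSpace.Harmonic.Constructions
import Mathlib.Analysis.SpecialFunctions.Complex.Analytic
import Mathlib.Analysis.SpecialFunctions.Complex.Arg
import Mathlib.Analysis.SpecialFunctions.Trigonometric.ArctanDeriv
import Mathlib.Analysis.SpecialFunctions.Trigonometric.Bounds
import Mathlib.Analysis.SpecialFunctions.Integrals.Basic
import Mathlib.Analysis.SpecialFunctions.ImproperIntegrals
import Mathlib.Analysis.SpecificLimits.Basic
import Mathlib.MeasureTheory.Function.JacobianOneDim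
import Mathlib.MeasureTheory.Measure.Haar.NormedSpace
import Mathlib.MeasureTheory.Group.Integral
import Mathlib.MeasureTheory.Integral.Lebesgue.Markov
import HarnessLib

/-!
# Turán–Nazarov inequality, proofs — Part 2: the weak Cauchy estimate

Second file of the formalization of O. Friedland, *A disk-growth Remez principle and a modular
proof of the measurable Turán–Nazarov inequality*, arXiv:2606.24823 (2026)
[Friedland2026DiskGrowthRemez], towards discharging
`Literature.Analysis.Approximation.TuranNazarov.lemma` (road map in
`Literature/Analysis/Approximation/TuranNazarovProofs.lean`).  Theorems only.

This part proves **Lemma B.2 (weak Cauchy estimate)**: for arbitrary `ζ_1, …, ζ_N ∈ ℂ` and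
`y > 0`,
  `|{x ∈ ℝ : |∑_j 1/(x - ζ_j)| > y}| ≤ (8 + 2π) N / y`       (`weak_cauchy`).
The paper derives it from the weak-type `(1,1)` inequality for the Hilbert transform, which
Mathlib does not have; we give instead a self-contained HARMONIC-MEASURE proof using only the
mean value property of harmonic functions on a disc (Mathlib's `HarmonicOnNhd.circleAverage_eq`):

* `weak_cauchy_core`: poles strictly in the lower half-plane, `S ⊆ [-X₀, X₀]` measurable with
  `Re Φ > y` on `S` (`Φ = ∑ 1/(· - ζ_j)`), `Ty > N`.  The rational function
  `G = Φ ∘ (T · Cayley)`, `G(w) = ∑_j (1-w)/(iT(1+w) - ζ_j(1-w))`, is analytic on the closed unit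
  disc and maps it into the closed lower half-plane (`Im G < 0` off `w = 1`, `G(1) = 0`), so
  `H = π⁻¹ arg(y - G)` is harmonic there, `≥ 0` on the circle, `≥ 1/2` at the circle points
  `w_x = (x - iT)/(x + iT) = e^{i(π + 2 arctan(x/T))}`, `x ∈ S` (`cayley_term`, `circleMap_cayley`),
  and `H(0) = π⁻¹ arg(y - Φ(iT)) ≤ N/(π(Ty - N))`.  The mean value property and the change of
  variables `θ = π + 2 arctan(x/T)` (Mathlib's `lintegral_deriv_eq_volume_image_of_monotoneOn`)
  give `|S| · T/(2π(T² + X₀²)) ≤ N/(π(Ty - N))`.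
* `weak_cauchy_re_lower`: `T → ∞` gives `|{Re Φ > y}| ≤ 2N/y` for poles in the lower half-plane
  (twice Boole's exact value for real poles).
* `weak_cauchy_re`: arbitrary poles — push `ζ_j` to `Re ζ_j - i(|Im ζ_j| + 1/(n+1))`, which leaves
  the pointwise limit of the real parts on the line unchanged (junk value `1/0 = 0` included),
  and pass to the limit through the monotone union `⋃_n ⋂_{k ≥ n}`; `weak_cauchy_re_neg`: the
  set `{Re Φ < -y}` by the reflection `x ↦ -x`.
* `poisson_term_integral`, `weak_cauchy_im`: `|Im Φ| ≤ ∑_j |Im ζ_j| /((x - Re ζ_j)² + (Im ζ_j)²)`,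
  of integral `≤ πN`; Markov.
* `weak_cauchy`: `‖Φ‖ ≤ |Re Φ| + |Im Φ|` and the three bounds at level `y/2`.
-/

noncomputable section

open Finset Complex MeasureTheory Set

namespace Literature.Analysis.Approximation

namespace TuranNazarov

section WeakCauchy

variable {ι : Type*} [Fintype ι]

/-- Cayley bookkeeping: at the boundary point `w_x = (x - iT)/(x + iT)` of the unit circle the `j`-th
term of `G = Φ ∘ (T · Cayley)` equals `1/(x - ζ)`. [folklore] -/
theorem cayley_term (ζ : ℂ) {T : ℝ} (hT : 0 < T) (x : ℝ) :
    (1 - ((x : ℂ) - T * I) / ((x : ℂ) + T * I)) /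
        (I * T * (1 + ((x : ℂ) - T * I) / ((x : ℂ) + T * I)) -
          ζ * (1 - ((x : ℂ) - T * I) / ((x : ℂ) + T * I))) = ((x : ℂ) - ζ)⁻¹ := by
  have hx : (x : ℂ) + T * I ≠ 0 := by
    intro h
    have := congrArg Complex.im h
    simp at this
    exact hT.ne' this
  have hT0 : (T : ℂ) ≠ 0 := by exact_mod_cast hT.ne'
  have h1 : 1 - ((x : ℂ) - T * I) / ((x : ℂ) + T * I) = 2 * T * I / ((x : ℂ) + T * I) := by
    rw [one_sub_div hx]; congr 1; ring
  have h2 : I * T * (1 + ((x : ℂ) - T * I) / ((x : ℂ) + T * I)) -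
      ζ * (1 - ((x : ℂ) - T * I) / ((x : ℂ) + T * I)) =
      2 * T * I * ((x : ℂ) - ζ) / ((x : ℂ) + T * I) := by
    rw [one_add_div hx, one_sub_div hx, mul_div_assoc', mul_div_assoc', ← sub_div]
    congr 1
    ring
  rw [h2, h1]
  rcases eq_or_ne ((x : ℂ) - ζ) 0 with h0 | h0
  · rw [h0]; simp
  · have h3 : (2 : ℂ) * T * I ≠ 0 := by simp [hT0, Complex.I_ne_zero]
    field_simp

/-- The circle point: `exp(i(π + 2 arctan(x/T))) = (x - iT)/(x + iT)`. [folklore] -/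
theorem circleMap_cayley {T : ℝ} (hT : 0 < T) (x : ℝ) :
    circleMap 0 1 (Real.pi + 2 * Real.arctan (x / T)) = ((x : ℂ) - T * I) / ((x : ℂ) + T * I) := by
  have hx : (x : ℂ) + T * I ≠ 0 := by
    intro h
    have := congrArg Complex.im h
    simp at this
    exact hT.ne' this
  set u : ℝ := x / T with hu
  have hs : 0 < Real.sqrt (1 + u ^ 2) := Real.sqrt_pos.2 (by positivity)
  have hexp : cexp (↑(Real.arctan u) * I) = (1 + u * I) / (Real.sqrt (1 + u ^ 2) : ℂ) := by
    rw [Complex.exp_mul_I, ← Complex.ofReal_cos, ← Complex.ofReal_sin, Real.cos_arctan,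
      Real.sin_arctan]
    push_cast
    field_simp
  have hsq : ((Real.sqrt (1 + u ^ 2) : ℝ) : ℂ) ^ 2 = 1 + (u : ℂ) ^ 2 := by
    rw [← Complex.ofReal_pow, Real.sq_sqrt (by positivity)]; push_cast; ring
  rw [circleMap_zero, Complex.ofReal_one, one_mul]
  have e1 : cexp (↑(Real.pi + 2 * Real.arctan u) * I) =
      -((1 + u * I) / (Real.sqrt (1 + u ^ 2) : ℂ)) ^ 2 := by
    have : (↑(Real.pi + 2 * Real.arctan u) : ℂ) * I =
        ↑Real.pi * I + (↑(Real.arctan u) * I + ↑(Real.arctan u) * I) := by push_cast; ring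
    rw [this, Complex.exp_add, Complex.exp_pi_mul_I, Complex.exp_add, hexp]
    ring
  rw [e1, div_pow, hsq, ← neg_div]
  have h1u : (1 : ℂ) + (u : ℂ) ^ 2 ≠ 0 := by norm_cast; positivity
  rw [div_eq_div_iff h1u hx]
  have hT0 : (T : ℂ) ≠ 0 := by exact_mod_cast hT.ne'
  have huT : (u : ℂ) * T = x := by rw [hu]; push_cast; field_simp
  have key : -(1 + (u : ℂ) * I) ^ 2 * ((x : ℂ) + T * I) * T ^ 2 =
      ((x : ℂ) - T * I) * (1 + (u : ℂ) ^ 2) * T ^ 2 := by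
    have e2 : ((x : ℂ) - T * I) * (1 + (u : ℂ) ^ 2) * T ^ 2 =
        ((x : ℂ) - T * I) * (T ^ 2 + ((u : ℂ) * T) ^ 2) := by ring
    have e3 : -(1 + (u : ℂ) * I) ^ 2 * ((x : ℂ) + T * I) * T ^ 2 =
        -(T + ((u : ℂ) * T) * I) ^ 2 * ((x : ℂ) + T * I) := by ring
    rw [e2, e3, huT]
    ring_nf
    rw [Complex.I_sq, Complex.I_pow_three]
    ring
  have hT2 : (T : ℂ) ^ 2 ≠ 0 := pow_ne_zero 2 hT0
  exact mul_right_cancel₀ hT2 key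

/-- Core of the weak Cauchy estimate (harmonic-measure argument): if all poles lie strictly in
the lower half-plane, `S` is a measurable subset of `[-X₀, X₀]` on which `Re ∑ 1/(x-ζ_j) > y`,
and `T y > N`, then `|S| · T/(2π(T²+X₀²)) ≤ N/(π(Ty - N))`.  Proof: `H = π⁻¹ arg(y - Φ∘(T·Cayley))`
is harmonic on the closed unit disc, `≥ 0` on the circle and `≥ 1/2` on the image of `S`; the mean
value property at the centre, where `H ≤ N/(π(Ty-N))`, gives the claim.
[cite: Friedland2026DiskGrowthRemez, Lemma B.2 (harmonic-measure proof replacing the Hilbert transform)] -/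
theorem weak_cauchy_core (ζ : ι → ℂ) (hζ : ∀ j, (ζ j).im < 0) {y T X₀ : ℝ} (hy : 0 < y)
    (hT : 0 < T) (hTy : (Fintype.card ι : ℝ) < T * y) {S : Set ℝ} (hSm : MeasurableSet S)
    (hSX : S ⊆ Icc (-X₀) X₀)
    (hSΦ : ∀ x ∈ S, y < (∑ j, ((x : ℂ) - ζ j)⁻¹).re) :
    (volume S).toReal * (T / (2 * Real.pi * (T ^ 2 + X₀ ^ 2))) ≤
      Fintype.card ι / (Real.pi * (T * y - Fintype.card ι)) := by
  classical
  set N : ℕ := Fintype.card ι with hN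
  have hπ := Real.pi_pos
  rcases isEmpty_or_nonempty ι with hι | hι
  · have hS0 : S = ∅ := by
      rcases S.eq_empty_or_nonempty with h | ⟨x, hx⟩
      · exact h
      · have := hSΦ x hx; simp at this; linarith
    have : N = 0 := by simp [hN]
    simp [hS0, this]
  -- the rational function `G = Φ ∘ (T • Cayley)` and the harmonic majorant `H`
  set den : ι → ℂ → ℂ := fun j w => I * T * (1 + w) - ζ j * (1 - w) with hden_def
  set G : ℂ → ℂ := fun w => ∑ j, (1 - w) / den j w with hG_def
  set H : ℂ → ℝ := Real.pi⁻¹ • fun w => (Complex.log ((y : ℂ) - G w)).im with hH_def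
  have hH : ∀ w, H w = Real.pi⁻¹ * arg ((y : ℂ) - G w) := fun w => by
    simp [hH_def, Complex.log_im]
  -- (a) denominators do not vanish on the closed unit disc
  have hden : ∀ w : ℂ, ‖w‖ ≤ 1 → ∀ j, den j w ≠ 0 := by
    intro w hw j h0
    have h1 : w * (ζ j + I * T) = ζ j - I * T := by
      have : I * T * (1 + w) - ζ j * (1 - w) = 0 := h0
      linear_combination this
    have hlt : ‖ζ j + I * T‖ < ‖ζ j - I * T‖ := by
      rw [← sq_lt_sq₀ (norm_nonneg _) (norm_nonneg _), Complex.sq_norm, Complex.sq_norm,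
        Complex.normSq_apply, Complex.normSq_apply]
      simp only [add_re, sub_re, mul_re, I_re, I_im, ofReal_re, ofReal_im, add_im, sub_im,
        mul_im]
      nlinarith [hζ j, hT]
    have h2 : ‖ζ j - I * T‖ = ‖w‖ * ‖ζ j + I * T‖ := by rw [← norm_mul, h1]
    have h3 : ‖w‖ * ‖ζ j + I * T‖ ≤ 1 * ‖ζ j + I * T‖ := by gcongr
    linarith
  -- (b) the imaginary part of `G` on the closed disc
  have hGim : ∀ w : ℂ, ‖w‖ ≤ 1 → (G w).im ≤ 0 ∧ (w ≠ 1 → (G w).im < 0) := by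
    intro w hw
    have hterm : ∀ j, ((1 - w) / den j w).im ≤ 0 ∧ (w ≠ 1 → ((1 - w) / den j w).im < 0) := by
      intro j
      have hd := hden w hw j
      have hns : 0 < Complex.normSq (den j w) := Complex.normSq_pos.2 hd
      have key : ((1 - w) / den j w).im =
          (-T * (1 - Complex.normSq w) + (ζ j).im * Complex.normSq (1 - w)) /
            Complex.normSq (den j w) := by
        rw [Complex.div_im, div_sub_div_same]
        congr 1
        simp only [hden_def, sub_re, one_re, sub_im, one_im, mul_re, mul_im, add_re, add_im, I_re,
          I_im, ofReal_re, ofReal_im, Complex.normSq_apply]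
        ring
      have hw2 : Complex.normSq w ≤ 1 := by
        rw [Complex.normSq_eq_norm_sq]; nlinarith [norm_nonneg w]
      have hA : -T * (1 - Complex.normSq w) ≤ 0 := by nlinarith
      have hB : (ζ j).im * Complex.normSq (1 - w) ≤ 0 :=
        mul_nonpos_of_nonpos_of_nonneg (hζ j).le (Complex.normSq_nonneg _)
      refine ⟨?_, fun hw1 => ?_⟩
      · rw [key]; exact div_nonpos_of_nonpos_of_nonneg (by linarith) hns.le
      · rw [key]
        apply div_neg_of_neg_of_pos _ hns
        have : 0 < Complex.normSq (1 - w) := Complex.normSq_pos.2 (sub_ne_zero.2 (Ne.symm hw1))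
        nlinarith [hζ j]
    have hsum : (G w).im = ∑ j, ((1 - w) / den j w).im := by
      simp only [hG_def, Complex.im_sum]
    obtain ⟨j₀⟩ := hι
    constructor
    · rw [hsum]; exact Finset.sum_nonpos fun j _ => (hterm j).1
    · intro hw1
      rw [hsum, ← Finset.sum_erase_add _ _ (Finset.mem_univ j₀)]
      have h1 := (hterm j₀).2 hw1
      have h2 : ∑ j ∈ Finset.univ.erase j₀, ((1 - w) / den j w).im ≤ 0 :=
        Finset.sum_nonpos fun j _ => (hterm j).1
      linarith
  -- (c) `y - G` takes values in the slit plane on the closed disc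
  have hG1 : G 1 = 0 := by simp [hG_def]
  have hslit : ∀ w : ℂ, ‖w‖ ≤ 1 → (y : ℂ) - G w ∈ slitPlane := by
    intro w hw
    rw [Complex.mem_slitPlane_iff]
    rcases eq_or_ne w 1 with rfl | hw1
    · left; simp [hG1, hy]
    · right
      have := (hGim w hw).2 hw1
      simp only [sub_im, ofReal_im]
      linarith
  -- (d) analyticity of `G` and harmonicity of `H` on the closed disc
  have hGan : ∀ w : ℂ, ‖w‖ ≤ 1 → AnalyticAt ℂ G w := by
    intro w hw
    simp only [hG_def]
    apply Finset.analyticAt_fun_sum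
    intro j _
    exact AnalyticAt.div (by fun_prop) (by simp only [hden_def]; fun_prop) (hden w hw j)
  have hHarm : InnerProductSpace.HarmonicOnNhd H (Metric.closedBall (0 : ℂ) |1|) := by
    intro w hw
    rw [abs_one, Metric.mem_closedBall, dist_zero_right] at hw
    simp only [hH_def]
    apply InnerProductSpace.HarmonicAt.const_smul
    exact AnalyticAt.harmonicAt_im ((analyticAt_const.sub (hGan w hw)).clog (hslit w hw))
  -- (e) mean value property
  have hmv : Real.circleAverage H 0 1 = H 0 := HarmonicOnNhd.circleAverage_eq hHarm
  -- (f) upper bound at the centre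
  have hG0 : G 0 = ∑ j, (I * T - ζ j)⁻¹ := by simp [hG_def, hden_def]
  have hG0n : ‖G 0‖ ≤ N / T := by
    rw [hG0]
    calc ‖∑ j, (I * T - ζ j)⁻¹‖ ≤ ∑ j, ‖(I * T - ζ j)⁻¹‖ := norm_sum_le _ _
      _ ≤ ∑ _j, T⁻¹ := by
          refine Finset.sum_le_sum fun j _ => ?_
          rw [norm_inv]
          apply inv_anti₀ hT
          calc T ≤ |(I * T - ζ j).im| := by
                simp only [sub_im, mul_im, I_re, I_im, ofReal_re, ofReal_im]
                rw [abs_of_pos (by nlinarith [hζ j])]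
                linarith [hζ j]
            _ ≤ ‖I * T - ζ j‖ := Complex.abs_im_le_norm _
      _ = N / T := by simp [hN, div_eq_mul_inv]
  have hNT : (N : ℝ) / T < y := by rw [div_lt_iff₀ hT]; linarith
  have hH0 : H 0 ≤ N / (Real.pi * (T * y - N)) := by
    rw [hH]
    set v : ℂ := (y : ℂ) - G 0 with hv
    have hvre : y - N / T ≤ v.re := by
      have : |(G 0).re| ≤ ‖G 0‖ := Complex.abs_re_le_norm _
      simp only [hv, sub_re, ofReal_re]
      linarith [(abs_le.1 this).2]
    have hvre0 : 0 < v.re := by linarith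
    have hvim : 0 ≤ v.im := by
      have := (hGim 0 (by simp)).1
      simp only [hv, sub_im, ofReal_im]; linarith
    have hvim' : v.im ≤ N / T := by
      have : |(G 0).im| ≤ ‖G 0‖ := Complex.abs_im_le_norm _
      simp only [hv, sub_im, ofReal_im]
      linarith [(abs_le.1 this).1]
    have harg0 : 0 ≤ arg v := Complex.arg_nonneg_iff.2 hvim
    have harg1 : arg v < Real.pi / 2 := Complex.arg_lt_pi_div_two_iff.2 (Or.inl hvre0)
    have harg : arg v ≤ N / T / (y - N / T) := by
      calc arg v ≤ Real.tan (arg v) := Real.le_tan harg0 harg1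
        _ = v.im / v.re := Complex.tan_arg v
        _ ≤ N / T / (y - N / T) := div_le_div₀ (by positivity) hvim' (by linarith) hvre
    calc Real.pi⁻¹ * arg v ≤ Real.pi⁻¹ * (N / T / (y - N / T)) := by gcongr
      _ = N / (Real.pi * (T * y - N)) := by
          field_simp
  -- (g) the change of variables `θ = π + 2 arctan (x/T)`
  set g : ℝ → ℝ := fun x => Real.pi + 2 * Real.arctan (x / T) with hg_def
  set g' : ℝ → ℝ := fun x => 2 * T / (T ^ 2 + x ^ 2) with hg'_def
  have hgd : ∀ x, HasDerivAt g (g' x) x := by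
    intro x
    have h1 : HasDerivAt (fun x : ℝ => x / T) (1 / T) x := by
      simpa using (hasDerivAt_id x).div_const T
    have h2 := (h1.arctan).const_mul 2 |>.const_add Real.pi
    have h3 : 2 * (1 / (1 + (x / T) ^ 2) * (1 / T)) = g' x := by
      simp only [hg'_def]
      field_simp
    exact h2.congr_deriv h3
  have hgmono : StrictMono g := by
    intro a b hab
    simp only [hg_def]
    have : Real.arctan (a / T) < Real.arctan (b / T) :=
      Real.arctan_strictMono (div_lt_div_of_pos_right hab hT)
    linarith
  have hgS : g '' S ⊆ Ioc 0 (2 * Real.pi) := by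
    rintro _ ⟨x, _, rfl⟩
    show Real.pi + 2 * Real.arctan (x / T) ∈ Ioc 0 (2 * Real.pi)
    rw [Set.mem_Ioc]
    constructor
    · linarith [Real.neg_pi_div_two_lt_arctan (x / T)]
    · linarith [Real.arctan_lt_pi_div_two (x / T)]
  have hgSm : MeasurableSet (g '' S) := hSm.image_of_monotoneOn (hgmono.monotone.monotoneOn S)
  have hvolgS : ENNReal.ofReal (2 * T / (T ^ 2 + X₀ ^ 2)) * volume S ≤ volume (g '' S) := by
    rw [← lintegral_deriv_eq_volume_image_of_monotoneOn hSm (fun x _ => (hgd x).hasDerivWithinAt)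
      (hgmono.monotone.monotoneOn S), ← setLIntegral_const]
    apply setLIntegral_mono' hSm
    intro x hx
    apply ENNReal.ofReal_le_ofReal
    simp only [hg'_def]
    have hxX : x ^ 2 ≤ X₀ ^ 2 := by
      have := hSX hx
      rw [Set.mem_Icc] at this
      nlinarith [this.1, this.2]
    apply div_le_div_of_nonneg_left (by linarith) (by positivity)
    linarith
  have hvolgS_fin : volume (g '' S) ≠ ⊤ :=
    ne_top_of_le_ne_top (measure_Ioc_lt_top (a := (0:ℝ)) (b := 2 * Real.pi)).ne
      (measure_mono hgS)
  have hvolS_fin : volume S ≠ ⊤ :=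
    ne_top_of_le_ne_top (measure_Icc_lt_top (a := -X₀) (b := X₀)).ne (measure_mono hSX)
  -- (h) values of `H` on the circle
  have hHnonneg : ∀ θ : ℝ, 0 ≤ H (circleMap 0 1 θ) := by
    intro θ
    rw [hH]
    have hw : ‖circleMap 0 1 θ‖ ≤ 1 := by rw [norm_circleMap_zero, abs_one]
    have := (hGim _ hw).1
    apply mul_nonneg (inv_nonneg.2 hπ.le)
    apply Complex.arg_nonneg_iff.2
    simp only [sub_im, ofReal_im]
    linarith
  have hHhalf : ∀ θ ∈ g '' S, (1 / 2 : ℝ) ≤ H (circleMap 0 1 θ) := by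
    rintro _ ⟨x, hx, rfl⟩
    rw [hH]
    have hcm : circleMap 0 1 (g x) = ((x : ℂ) - T * I) / ((x : ℂ) + T * I) := circleMap_cayley hT x
    have hGx : G (circleMap 0 1 (g x)) = ∑ j, ((x : ℂ) - ζ j)⁻¹ := by
      rw [hcm]
      simp only [hG_def, hden_def]
      exact Finset.sum_congr rfl fun j _ => cayley_term (ζ j) hT x
    have hw : ‖circleMap 0 1 (g x)‖ ≤ 1 := by rw [norm_circleMap_zero, abs_one]
    have him := (hGim _ hw).1
    have hre := hSΦ x hx
    rw [hGx] at him
    have harg : Real.pi / 2 < arg ((y : ℂ) - ∑ j, ((x : ℂ) - ζ j)⁻¹) := by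
      rw [← not_le, Complex.arg_le_pi_div_two_iff, not_or, not_le, not_lt]
      simp only [sub_re, ofReal_re, sub_im, ofReal_im]
      constructor <;> linarith
    rw [hGx]
    rw [le_iff_lt_or_eq]; left
    calc (1 / 2 : ℝ) = Real.pi⁻¹ * (Real.pi / 2) := by field_simp
      _ < Real.pi⁻¹ * arg ((y : ℂ) - ∑ j, ((x : ℂ) - ζ j)⁻¹) := by gcongr
  -- (i) continuity / integrability of `H ∘ circleMap`
  have hHcont : Continuous fun θ : ℝ => H (circleMap 0 1 θ) := by
    rw [continuous_iff_continuousAt]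
    intro θ
    have hw : circleMap 0 1 θ ∈ Metric.closedBall (0 : ℂ) |1| := by
      rw [Metric.mem_closedBall, dist_zero_right, norm_circleMap_zero]
    exact ((hHarm _ hw).1.continuousAt).comp (continuous_circleMap 0 1).continuousAt
  have hHint : IntegrableOn (fun θ : ℝ => H (circleMap 0 1 θ)) (Ioc 0 (2 * Real.pi)) volume :=
    (hHcont.integrableOn_Icc (a := 0) (b := 2 * Real.pi)).mono_set Ioc_subset_Icc_self
  -- (j) the lower bound for the circle average
  have hlow : (1 / 2 : ℝ) * (volume (g '' S)).toReal ≤ ∫ θ in Ioc 0 (2 * Real.pi), H (circleMap 0 1 θ) := by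
    calc (1 / 2 : ℝ) * (volume (g '' S)).toReal
        ≤ ∫ θ in g '' S, H (circleMap 0 1 θ) :=
          setIntegral_ge_of_const_le_real hgSm hvolgS_fin hHhalf (hHint.mono_set hgS)
      _ ≤ ∫ θ in Ioc 0 (2 * Real.pi), H (circleMap 0 1 θ) := by
          apply setIntegral_mono_set hHint
          · exact Filter.Eventually.of_forall fun θ => hHnonneg θ
          · exact Filter.Eventually.of_forall hgS
  have havg : Real.circleAverage H 0 1 =
      (2 * Real.pi)⁻¹ * ∫ θ in Ioc 0 (2 * Real.pi), H (circleMap 0 1 θ) := by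
    rw [Real.circleAverage_def, intervalIntegral.integral_of_le (by positivity), smul_eq_mul]
  -- (k) assemble
  have hvolS : 2 * T / (T ^ 2 + X₀ ^ 2) * (volume S).toReal ≤ (volume (g '' S)).toReal := by
    have := ENNReal.toReal_mono hvolgS_fin hvolgS
    rwa [ENNReal.toReal_mul, ENNReal.toReal_ofReal (by positivity)] at this
  have hchain : (2 * Real.pi)⁻¹ * ((1 / 2 : ℝ) * (2 * T / (T ^ 2 + X₀ ^ 2) * (volume S).toReal)) ≤
      N / (Real.pi * (T * y - N)) := by
    calc (2 * Real.pi)⁻¹ * ((1 / 2 : ℝ) * (2 * T / (T ^ 2 + X₀ ^ 2) * (volume S).toReal))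
        ≤ (2 * Real.pi)⁻¹ * ((1 / 2 : ℝ) * (volume (g '' S)).toReal) := by gcongr
      _ ≤ (2 * Real.pi)⁻¹ * ∫ θ in Ioc 0 (2 * Real.pi), H (circleMap 0 1 θ) := by gcongr
      _ = H 0 := by rw [← havg, hmv]
      _ ≤ N / (Real.pi * (T * y - N)) := hH0
  calc (volume S).toReal * (T / (2 * Real.pi * (T ^ 2 + X₀ ^ 2)))
      = (2 * Real.pi)⁻¹ * ((1 / 2 : ℝ) * (2 * T / (T ^ 2 + X₀ ^ 2) * (volume S).toReal)) := by
        field_simp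
    _ ≤ N / (Real.pi * (T * y - N)) := hchain


/-- One-sided weak Cauchy estimate for poles strictly in the lower half-plane:
`|{x : Re ∑ 1/(x-ζ_j) > y}| ≤ 2N/y`. [cite: Friedland2026DiskGrowthRemez, Lemma B.2] -/
theorem weak_cauchy_re_lower (ζ : ι → ℂ) (hζ : ∀ j, (ζ j).im < 0) {y : ℝ} (hy : 0 < y) :
    volume {x : ℝ | y < (∑ j, ((x : ℂ) - ζ j)⁻¹).re} ≤
      ENNReal.ofReal (2 * Fintype.card ι / y) := by
  classical
  set N : ℕ := Fintype.card ι with hN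
  set S : Set ℝ := {x : ℝ | y < (∑ j, ((x : ℂ) - ζ j)⁻¹).re} with hS
  have hcont : Continuous fun x : ℝ => (∑ j, ((x : ℂ) - ζ j)⁻¹).re := by
    refine Complex.continuous_re.comp (continuous_finsetSum _ fun j _ => ?_)
    refine Continuous.inv₀ (by fun_prop) fun x h => ?_
    have := congrArg Complex.im h
    simp at this
    linarith [hζ j]
  have hSm : MeasurableSet S := (isOpen_lt continuous_const hcont).measurableSet
  -- boundedness of `S`
  set R₀ : ℝ := ∑ j, ‖ζ j‖ with hR₀
  have hR₀j : ∀ j, ‖ζ j‖ ≤ R₀ := fun j =>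
    Finset.single_le_sum (f := fun j => ‖ζ j‖) (fun _ _ => norm_nonneg _) (Finset.mem_univ j)
  have hR₀0 : 0 ≤ R₀ := Finset.sum_nonneg fun _ _ => norm_nonneg _
  set X₀ : ℝ := R₀ + N / y + 1 with hX₀
  have hSX : S ⊆ Icc (-X₀) X₀ := by
    intro x hx
    by_contra hxX
    have hxabs : X₀ < |x| := by
      rw [Set.mem_Icc, not_and_or, not_le, not_le] at hxX
      rcases hxX with h | h
      · have h0 : (0:ℝ) ≤ N / y := by positivity
        have : x < 0 := by linarith
        rw [abs_of_neg this]; linarith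
      · exact lt_of_lt_of_le h (le_abs_self x)
    have hdist : ∀ j, |x| - R₀ ≤ ‖(x : ℂ) - ζ j‖ := fun j => by
      have h1 : ‖(x : ℂ)‖ - ‖ζ j‖ ≤ ‖(x : ℂ) - ζ j‖ := norm_sub_norm_le _ _
      rw [Complex.norm_real, Real.norm_eq_abs] at h1
      linarith [hR₀j j]
    have hNy : (0:ℝ) ≤ N / y := by positivity
    have hpos : 0 < |x| - R₀ := by linarith
    have hnorm : ‖∑ j, ((x : ℂ) - ζ j)⁻¹‖ ≤ N / (|x| - R₀) := by
      calc ‖∑ j, ((x : ℂ) - ζ j)⁻¹‖ ≤ ∑ j, ‖((x : ℂ) - ζ j)⁻¹‖ := norm_sum_le _ _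
        _ ≤ ∑ _j, (|x| - R₀)⁻¹ := Finset.sum_le_sum fun j _ => by
            rw [norm_inv]; exact inv_anti₀ hpos (hdist j)
        _ = N / (|x| - R₀) := by simp [hN, div_eq_mul_inv]
    have hle : (N : ℝ) / (|x| - R₀) ≤ y := by
      rw [div_le_iff₀ hpos]
      have : (N : ℝ) = y * (N / y) := by field_simp
      nlinarith
    have hre : (∑ j, ((x : ℂ) - ζ j)⁻¹).re ≤ ‖∑ j, ((x : ℂ) - ζ j)⁻¹‖ := Complex.re_le_norm _
    have := hx
    simp only [hS, Set.mem_setOf_eq] at this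
    linarith
  have hfin : volume S ≠ ⊤ :=
    ne_top_of_le_ne_top (measure_Icc_lt_top (a := -X₀) (b := X₀)).ne (measure_mono hSX)
  -- the bound for every large `T`
  have hbound : ∀ T : ℝ, (N : ℝ) / y + 1 ≤ T →
      (volume S).toReal ≤ 2 * N * (T ^ 2 + X₀ ^ 2) / (T * (T * y - N)) := by
    intro T hT'
    have hNy : (0:ℝ) ≤ N / y := by positivity
    have hT : 0 < T := by linarith
    have hTy : (N : ℝ) < T * y := by
      have h1 : (N : ℝ) / y * y = N := div_mul_cancel₀ _ hy.ne'
      nlinarith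
    have key := weak_cauchy_core ζ hζ hy hT hTy hSm hSX (fun x hx => hx)
    have hpos : 0 < T / (2 * Real.pi * (T ^ 2 + X₀ ^ 2)) := by positivity
    rw [← le_div_iff₀ hpos] at key
    refine key.trans (le_of_eq ?_)
    rw [hN]
    field_simp
  -- let `T → ∞`
  have htend : Filter.Tendsto (fun T : ℝ => 2 * N * (T ^ 2 + X₀ ^ 2) / (T * (T * y - N)))
      Filter.atTop (nhds (2 * N / y)) := by
    have key : ∀ᶠ T in Filter.atTop, 2 * N * (1 + X₀ ^ 2 * T⁻¹ ^ 2) / (y - N * T⁻¹) =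
        2 * N * (T ^ 2 + X₀ ^ 2) / (T * (T * y - N)) := by
      filter_upwards [Filter.eventually_gt_atTop 0, Filter.eventually_gt_atTop ((N : ℝ) / y)]
        with T hT hT2
      have h3 : 0 < T * y - N := by rw [div_lt_iff₀ hy] at hT2; linarith
      field_simp
    apply Filter.Tendsto.congr' key
    have h0 : Filter.Tendsto (fun T : ℝ => T⁻¹) Filter.atTop (nhds 0) := tendsto_inv_atTop_zero
    have h1 : Filter.Tendsto (fun T : ℝ => 2 * N * (1 + X₀ ^ 2 * T⁻¹ ^ 2) / (y - N * T⁻¹))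
        Filter.atTop (nhds (2 * N * (1 + X₀ ^ 2 * 0 ^ 2) / (y - N * 0))) :=
      ((tendsto_const_nhds.add (tendsto_const_nhds.mul (h0.pow 2))).const_mul _).div
        (tendsto_const_nhds.sub (tendsto_const_nhds.mul h0)) (by simpa using hy.ne')
    simpa using h1
  have hle : (volume S).toReal ≤ 2 * N / y :=
    ge_of_tendsto htend (by
      filter_upwards [Filter.eventually_ge_atTop ((N : ℝ) / y + 1)] with T hT
      exact hbound T hT)
  calc volume S = ENNReal.ofReal (volume S).toReal := (ENNReal.ofReal_toReal hfin).symm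
    _ ≤ ENNReal.ofReal (2 * N / y) := ENNReal.ofReal_le_ofReal hle


/-- One-sided weak Cauchy estimate for arbitrary poles: `|{x : Re ∑ 1/(x-ζ_j) > y}| ≤ 2N/y`
(push the poles to `Re ζ_j - i(|Im ζ_j| + 1/(n+1))`, which does not change the limit of the real
parts on the line, and let `n → ∞`). [cite: Friedland2026DiskGrowthRemez, Lemma B.2] -/
theorem weak_cauchy_re (ζ : ι → ℂ) {y : ℝ} (hy : 0 < y) :
    volume {x : ℝ | y < (∑ j, ((x : ℂ) - ζ j)⁻¹).re} ≤
      ENNReal.ofReal (2 * Fintype.card ι / y) := by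
  classical
  set ζ' : ℕ → ι → ℂ := fun n j => ⟨(ζ j).re, -(|(ζ j).im| + 1 / ((n : ℝ) + 1))⟩ with hζ'
  have hζ'im : ∀ n j, (ζ' n j).im < 0 := fun n j => by
    have : (0 : ℝ) < 1 / ((n : ℝ) + 1) := by positivity
    simp only [hζ']
    linarith [abs_nonneg (ζ j).im]
  set S : ℕ → Set ℝ := fun n => {x | y < (∑ j, ((x : ℂ) - ζ' n j)⁻¹).re} with hS
  have hSn : ∀ n, volume (S n) ≤ ENNReal.ofReal (2 * Fintype.card ι / y) := fun n =>
    weak_cauchy_re_lower (ζ' n) (hζ'im n) hy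
  -- pointwise convergence of the real parts
  have hptw : ∀ x : ℝ, Filter.Tendsto (fun n => (∑ j, ((x : ℂ) - ζ' n j)⁻¹).re) Filter.atTop
      (nhds ((∑ j, ((x : ℂ) - ζ j)⁻¹).re)) := by
    intro x
    simp only [Complex.re_sum]
    apply tendsto_finsetSum _ fun j _ => ?_
    have hε : Filter.Tendsto (fun n : ℕ => 1 / ((n : ℝ) + 1)) Filter.atTop (nhds 0) :=
      tendsto_one_div_add_atTop_nhds_zero_nat
    have hform : ∀ n, (((x : ℂ) - ζ' n j)⁻¹).re =
        (x - (ζ j).re) / ((x - (ζ j).re) ^ 2 + (|(ζ j).im| + 1 / ((n : ℝ) + 1)) ^ 2) := by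
      intro n
      rw [Complex.inv_re, Complex.normSq_apply]
      simp only [hζ', sub_re, ofReal_re, sub_im, ofReal_im]
      ring_nf
    have hlim : (((x : ℂ) - ζ j)⁻¹).re =
        (x - (ζ j).re) / ((x - (ζ j).re) ^ 2 + (|(ζ j).im| + 0) ^ 2) := by
      rw [Complex.inv_re, Complex.normSq_apply, add_zero, sq_abs]
      simp only [sub_re, ofReal_re, sub_im, ofReal_im]
      ring_nf
    rw [hlim]
    simp_rw [hform]
    rcases eq_or_ne (x - (ζ j).re) 0 with h0 | h0
    · simp [h0]
    · apply Filter.Tendsto.div tendsto_const_nhds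
      · exact tendsto_const_nhds.add ((tendsto_const_nhds.add hε).pow 2)
      · have : 0 < (x - (ζ j).re) ^ 2 := by positivity
        positivity
  -- the level set is contained in the liminf of the perturbed level sets
  set E : ℕ → Set ℝ := fun n => ⋂ k, ⋂ (_ : n ≤ k), S k with hE
  have hsub : {x : ℝ | y < (∑ j, ((x : ℂ) - ζ j)⁻¹).re} ⊆ ⋃ n, E n := by
    intro x hx
    have h1 := (hptw x).eventually_const_lt hx
    rw [Filter.eventually_atTop] at h1
    obtain ⟨n, hn⟩ := h1
    refine Set.mem_iUnion.2 ⟨n, ?_⟩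
    simp only [hE, Set.mem_iInter]
    exact fun k hk => hn k hk
  have hEmono : Monotone E := by
    intro n m hnm x hx
    simp only [hE, Set.mem_iInter] at hx ⊢
    exact fun k hk => hx k (le_trans hnm hk)
  have hEle : ∀ n, volume (E n) ≤ ENNReal.ofReal (2 * Fintype.card ι / y) := fun n =>
    (measure_mono (Set.iInter₂_subset (s := fun k (_ : n ≤ k) => S k) n le_rfl)).trans (hSn n)
  calc volume {x : ℝ | y < (∑ j, ((x : ℂ) - ζ j)⁻¹).re} ≤ volume (⋃ n, E n) := measure_mono hsub
    _ = ⨆ n, volume (E n) := hEmono.measure_iUnion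
    _ ≤ ENNReal.ofReal (2 * Fintype.card ι / y) := iSup_le hEle

/-- The other side: `|{x : Re ∑ 1/(x-ζ_j) < -y}| ≤ 2N/y` (reflect `x ↦ -x`, `ζ ↦ -ζ`).
[cite: Friedland2026DiskGrowthRemez, Lemma B.2] -/
theorem weak_cauchy_re_neg (ζ : ι → ℂ) {y : ℝ} (hy : 0 < y) :
    volume {x : ℝ | (∑ j, ((x : ℂ) - ζ j)⁻¹).re < -y} ≤
      ENNReal.ofReal (2 * Fintype.card ι / y) := by
  have key := weak_cauchy_re (fun j => -ζ j) hy
  have hset : {x : ℝ | (∑ j, ((x : ℂ) - ζ j)⁻¹).re < -y} =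
      Neg.neg ⁻¹' {x : ℝ | y < (∑ j, ((x : ℂ) - -ζ j)⁻¹).re} := by
    ext x
    simp only [Set.mem_setOf_eq, Set.mem_preimage]
    have : ∑ j, (((-x : ℝ) : ℂ) - -ζ j)⁻¹ = -∑ j, ((x : ℂ) - ζ j)⁻¹ := by
      rw [← Finset.sum_neg_distrib]
      refine Finset.sum_congr rfl fun j _ => ?_
      rw [← inv_neg]; congr 1; push_cast; ring
    rw [this, Complex.neg_re]
    constructor <;> intro h <;> linarith
  rw [hset, (Measure.measurePreserving_neg (volume : Measure ℝ)).measure_preimage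
    (measurableSet_lt measurable_const (by fun_prop)).nullMeasurableSet]
  exact key


/-- A Poisson-kernel integral: `∫ |b| / ((x-a)² + b²) dx ≤ π` (with equality for `b ≠ 0`),
together with integrability. [folklore] -/
theorem poisson_term_integral (a b : ℝ) :
    Integrable (fun x : ℝ => |b| / ((x - a) ^ 2 + b ^ 2)) ∧
      ∫ x : ℝ, |b| / ((x - a) ^ 2 + b ^ 2) ≤ Real.pi := by
  rcases eq_or_ne b 0 with hb | hb
  · subst hb
    simp only [abs_zero, zero_div, integral_zero]
    exact ⟨integrable_zero _ _ _, Real.pi_pos.le⟩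
  have hb' : 0 < |b| := abs_pos.2 hb
  set k : ℝ → ℝ := fun u => (1 + u ^ 2)⁻¹ with hk
  have hrepr : (fun x : ℝ => |b| / ((x - a) ^ 2 + b ^ 2)) =
      fun x => |b|⁻¹ * k (|b|⁻¹ * (x - a)) := by
    funext x
    simp only [hk]
    have hb2 : (0 : ℝ) < (x - a) ^ 2 + b ^ 2 := by positivity
    rw [← sq_abs b]
    field_simp
    ring
  have hk_int : Integrable k := integrable_inv_one_add_sq
  have h1 : Integrable (fun x : ℝ => k (|b|⁻¹ * x)) := hk_int.comp_mul_left' (inv_ne_zero hb'.ne')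
  have h2 : Integrable (fun x : ℝ => k (|b|⁻¹ * (x - a))) := h1.comp_sub_right a
  have hint : Integrable (fun x : ℝ => |b|⁻¹ * k (|b|⁻¹ * (x - a))) := h2.const_mul _
  rw [hrepr]
  refine ⟨hint, le_of_eq ?_⟩
  rw [integral_const_mul]
  have h3 : ∫ x : ℝ, k (|b|⁻¹ * (x - a)) = ∫ x : ℝ, k (|b|⁻¹ * x) :=
    integral_sub_right_eq_self (fun x => k (|b|⁻¹ * x)) a
  rw [h3, Measure.integral_comp_mul_left, inv_inv, abs_abs, smul_eq_mul]
  simp only [hk, integral_univ_inv_one_add_sq]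
  field_simp

/-- Imaginary parts: `|{x : |Im ∑ 1/(x-ζ_j)| > y}| ≤ πN/y` (the imaginary part is dominated by a
sum of Poisson kernels of total mass `≤ πN`; Markov's inequality).
[cite: Friedland2026DiskGrowthRemez, Lemma B.2] -/
theorem weak_cauchy_im (ζ : ι → ℂ) {y : ℝ} (hy : 0 < y) :
    volume {x : ℝ | y < |(∑ j, ((x : ℂ) - ζ j)⁻¹).im|} ≤
      ENNReal.ofReal (Real.pi * Fintype.card ι / y) := by
  classical
  set P : ℝ → ℝ := fun x => ∑ j, |(ζ j).im| / ((x - (ζ j).re) ^ 2 + (ζ j).im ^ 2) with hP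
  have hP0 : ∀ x, 0 ≤ P x := fun x => Finset.sum_nonneg fun j _ => by positivity
  have hdom : ∀ x : ℝ, |(∑ j, ((x : ℂ) - ζ j)⁻¹).im| ≤ P x := by
    intro x
    rw [Complex.im_sum]
    refine (Finset.abs_sum_le_sum_abs _ _).trans (Finset.sum_le_sum fun j _ => le_of_eq ?_)
    rw [Complex.inv_im, Complex.normSq_apply, abs_div]
    simp only [sub_re, ofReal_re, sub_im, ofReal_im, zero_sub, neg_neg]
    congr 1
    rw [abs_of_nonneg (by nlinarith)]
    ring
  have hPint : Integrable P ∧ ∫ x, P x ≤ Real.pi * Fintype.card ι := by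
    have h := fun j => poisson_term_integral (ζ j).re (ζ j).im
    constructor
    · simp only [hP]
      exact integrable_finsetSum _ fun j _ => (h j).1
    · simp only [hP]
      rw [integral_finsetSum _ fun j _ => (h j).1]
      calc ∑ j, ∫ x : ℝ, |(ζ j).im| / ((x - (ζ j).re) ^ 2 + (ζ j).im ^ 2) ≤ ∑ _j : ι, Real.pi :=
            Finset.sum_le_sum fun j _ => (h j).2
        _ = Real.pi * Fintype.card ι := by simp [mul_comm]
  have hmeas : AEMeasurable (fun x => ENNReal.ofReal (P x)) volume :=
    hPint.1.aemeasurable.ennreal_ofReal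
  calc volume {x : ℝ | y < |(∑ j, ((x : ℂ) - ζ j)⁻¹).im|}
      ≤ volume {x : ℝ | ENNReal.ofReal y ≤ ENNReal.ofReal (P x)} := by
        refine measure_mono fun x hx => ?_
        exact ENNReal.ofReal_le_ofReal (le_trans (le_of_lt hx) (hdom x))
    _ ≤ (∫⁻ x, ENNReal.ofReal (P x)) / ENNReal.ofReal y :=
        meas_ge_le_lintegral_div hmeas (by simpa using hy) ENNReal.ofReal_ne_top
    _ = ENNReal.ofReal (∫ x, P x) / ENNReal.ofReal y := by
        rw [ofReal_integral_eq_lintegral_ofReal hPint.1 (Filter.Eventually.of_forall hP0)]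
    _ ≤ ENNReal.ofReal (Real.pi * Fintype.card ι) / ENNReal.ofReal y := by
        gcongr
        exact hPint.2
    _ = ENNReal.ofReal (Real.pi * Fintype.card ι / y) := (ENNReal.ofReal_div_of_pos hy).symm

/-- **Weak Cauchy estimate** (Friedland 2026, Lemma B.2; a weak-type `(1,1)` bound for Cauchy
sums, proved here without the Hilbert transform): for any `ζ_1, …, ζ_N ∈ ℂ` and `y > 0`,
`|{x ∈ ℝ : |∑_j 1/(x - ζ_j)| > y}| ≤ (8 + 2π) N / y` (real poles enter with the junk value
`1/0 = 0`, which changes the function only on a finite set). [cite: Friedland2026DiskGrowthRemez, Lemma B.2] -/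
theorem weak_cauchy (ζ : ι → ℂ) {y : ℝ} (hy : 0 < y) :
    volume {x : ℝ | y < ‖∑ j, ((x : ℂ) - ζ j)⁻¹‖} ≤
      ENNReal.ofReal ((8 + 2 * Real.pi) * Fintype.card ι / y) := by
  have hy2 : 0 < y / 2 := by linarith
  have hA := weak_cauchy_re ζ hy2
  have hB := weak_cauchy_re_neg ζ hy2
  have hC := weak_cauchy_im ζ hy2
  have hsub : {x : ℝ | y < ‖∑ j, ((x : ℂ) - ζ j)⁻¹‖} ⊆
      ({x : ℝ | y / 2 < (∑ j, ((x : ℂ) - ζ j)⁻¹).re} ∪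
        {x : ℝ | (∑ j, ((x : ℂ) - ζ j)⁻¹).re < -(y / 2)}) ∪
        {x : ℝ | y / 2 < |(∑ j, ((x : ℂ) - ζ j)⁻¹).im|} := by
    intro x hx
    simp only [Set.mem_setOf_eq, Set.mem_union] at hx ⊢
    have h1 := Complex.norm_le_abs_re_add_abs_im (∑ j, ((x : ℂ) - ζ j)⁻¹)
    by_contra hcon
    push Not at hcon
    obtain ⟨⟨h2, h3⟩, h4⟩ := hcon
    have : |(∑ j, ((x : ℂ) - ζ j)⁻¹).re| ≤ y / 2 := abs_le.2 ⟨by linarith, h2⟩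
    linarith
  calc volume {x : ℝ | y < ‖∑ j, ((x : ℂ) - ζ j)⁻¹‖}
      ≤ volume ({x : ℝ | y / 2 < (∑ j, ((x : ℂ) - ζ j)⁻¹).re} ∪
          {x : ℝ | (∑ j, ((x : ℂ) - ζ j)⁻¹).re < -(y / 2)}) +
        volume {x : ℝ | y / 2 < |(∑ j, ((x : ℂ) - ζ j)⁻¹).im|} :=
        (measure_mono hsub).trans (measure_union_le _ _)
    _ ≤ (ENNReal.ofReal (2 * Fintype.card ι / (y / 2)) + ENNReal.ofReal (2 * Fintype.card ι / (y / 2))) +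
        ENNReal.ofReal (Real.pi * Fintype.card ι / (y / 2)) := by
        gcongr
        exact (measure_union_le _ _).trans (add_le_add hA hB)
    _ = ENNReal.ofReal ((8 + 2 * Real.pi) * Fintype.card ι / y) := by
        rw [← ENNReal.ofReal_add (by positivity) (by positivity),
          ← ENNReal.ofReal_add (by positivity) (by positivity)]
        congr 1
        field_simp
        ring


end WeakCauchy

end TuranNazarov

end Literature.Analysis.Approximation
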